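import Summits.QuantumAdvantage.QuantumAdvantage.Theorems.LinnikCubicClassGroupsDegreeOnePrimesEscapeOdlyzkoSharpGains
import Summits.QuantumAdvantage.QuantumAdvantage.Theorems.LinnikCubicClassGroupsDegreeOnePrimesEscapeOdlyzkoRootDiscriminant
import Mathlib.NumberTheory.ZetaValues
import HarnessLib

/-!
# Odlyzko's bound with three differences, numeric form: `|d_K|^{1/n} ≳ 57.4^{r₁/n} · 21.47^{2r₂/n}`

Topic `Summits/QuantumAdvantage/QuantumAdvantage/Theorems`, helper file for the crux
`DegreeOnePrimesEscape` (stmt-QuantumAdvantage-11543, closed) of route `LinnikCubicClassGroups`;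
cell B2b-1 (linnik-cubic), PART A. HONEST FRAMING: the value of this file is a THEOREM (explicit,
kernel-checked discriminant bounds) — NOT summit progress.

From `OdlyzkoSharp.log_absdiscr_ge_odlyzko_sharp` (seven-point family, certified boundary
inequality) and the gains `G_ℝ ≥ 0.942`, `G_ℂ ≥ 0.652` (`…OdlyzkoSharpGains`):

* `log_absdiscr_ge_sharp_linear` — at `σ = 1 + h`, `0 < h ≤ 1/20`:
  `log|d_K| ≥ r₁(log 4π + γ + 0.942 − (183π²/400)h) + 2r₂(log 2π + γ + 0.652 − (183π²/600)h) − (183/50)(1/h + 1/(1+h)) + 24/25`;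
* `log_absdiscr_ge_sharp_signature` — **for EVERY number field `K` of degree `n = r₁ + 2r₂`:
  `log|d_K| ≥ r₁(log 4π + γ + 0.942) + 2r₂(log 2π + γ + 0.652) − (183/50)√(π²n/2) − 76`**;
* `lt_four_pi_exp_sharp`, `lt_two_pi_exp_sharp` — `57.4 < 4πe^{γ+0.942}`, `21.47 < 2πe^{γ+0.652}`;
  `absdiscr_ge_sharp_numeric(_totallyReal)`: **`|d_K| ≥ 21.47^n e^{−(183/50)√(π²n/2) − 76}` for every
  `K`, `|d_K| ≥ 57.4^n e^{−(183/50)√(π²n/2) − 76}` for totally real `K`**;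
* `exists_pow_le_absdiscr_of_lt_sharp(_totallyReal)` — **asymptotic root-discriminant bounds: for
  every `θ < 2πe^{γ+0.652} ≈ 21.48` (resp. `θ < 4πe^{γ+0.942} ≈ 57.41`) there is `N` with
  `θ^n ≤ |d_K|` for every (resp. every totally real) number field of degree `n ≥ N`.**

For comparison: Stark's method `(22.38, 11.19)` (tree, `Discriminant.*`), one difference
`(51.7, 20.18)` (tree, `OdlyzkoBound.*`), Odlyzko's published estimates by this method
`(58.6, 21.8)` [Odlyzko1977, (5), nine terms] and `(60.1, 22.2)` [(4), twelve terms], the limit of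
the method / explicit formulae `(60.8, 22.38)`, GRH `(215.3, 44.7)`.

## References

* A. M. Odlyzko, *Lower bounds for discriminants of number fields. II*, Tôhoku Math. J. 29 (1977)
  209–216, Theorem 1. [Odlyzko1977]
* A. M. Odlyzko, *Lower bounds for discriminants of number fields*, Acta Arith. 29 (1976) 275–297.
  [Odlyzko1976]
-/

noncomputable section

open scoped NumberField
open Complex Filter Topology Set NumberField NumberField.InfinitePlace

namespace Summit.QuantumAdvantage.QuantumAdvantage.Theorems.DegreeOnePrimesEscape

namespace OdlyzkoSharp

open Literature.NumberTheory.LFunctions Literature.NumberTheory.LFunctions.NumberField OdlyzkoBound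

/-! ### The bound at `σ = 1 + h` and its optimisation -/

variable (K : Type*) [Field K] [NumberField K]

/-- **Tangent-line form of the three-difference bound**: for `0 < h ≤ 1/20`,
`log|d_K| ≥ r₁(log 4π + γ + 0.942 − (183π²/400)h) + 2r₂(log 2π + γ + 0.652 − (183π²/600)h) − (183/50)(1/h + 1/(1+h)) + 24/25`.
[cite: Odlyzko1977, Theorem 1 (method; three-difference instance)] -/
theorem log_absdiscr_ge_sharp_linear {h : ℝ} (hh : 0 < h) (hh' : h ≤ 1 / 20) :
    (nrRealPlaces K : ℝ) * (Real.log (4 * Real.pi) + Real.eulerMascheroniConstant + 0.942 -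
        183 * Real.pi ^ 2 / 400 * h) +
      2 * (nrComplexPlaces K : ℝ) * (Real.log (2 * Real.pi) + Real.eulerMascheroniConstant + 0.652 -
        183 * Real.pi ^ 2 / 600 * h) -
      183 / 50 * (1 / h) - 183 / 50 * (1 / (1 + h)) + 24 / 25 ≤ Real.log ((discr K).natAbs : ℝ) := by
  have hmain := log_absdiscr_ge_odlyzko_sharp K (σ := 1 + h) (by linarith) (by linarith)
  have hψ1 := re_digamma_half_add_le hh.le
  have hψ2 := re_digamma_one_add_le hh.le
  have hgR := sharp_gain_real
  have hgC := sharp_gain_complex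
  rw [re_digamma_half] at hgR
  rw [re_digamma_one] at hgC
  have hcast1 : (((1 + h : ℝ)) : ℂ) / 2 = ((((1 + h) / 2 : ℝ)) : ℂ) := by push_cast; ring
  rw [hcast1, show (1 + h - 1 : ℝ) = h by ring] at hmain
  have h4π : Real.log (4 * Real.pi) = 2 * Real.log 2 + Real.log Real.pi := by
    rw [Real.log_mul (by norm_num) Real.pi_ne_zero, show (4 : ℝ) = 2 ^ 2 by norm_num, Real.log_pow]
    push_cast
    ring
  have hr1 : (0 : ℝ) ≤ nrRealPlaces K := Nat.cast_nonneg _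
  have hr2 : (0 : ℝ) ≤ nrComplexPlaces K := Nat.cast_nonneg _
  have e1 := mul_le_mul_of_nonneg_left hψ1 hr1
  have e2 := mul_le_mul_of_nonneg_left hψ2 hr2
  have e3 := mul_le_mul_of_nonneg_left hgR hr1
  have e4 := mul_le_mul_of_nonneg_left hgC hr2
  rw [h4π]
  linarith [e1, e2, e3, e4, hmain]

/-- **The three-difference bound, explicit in the degree**: for EVERY number field `K` of degree
`n = r₁ + 2r₂`, `log|d_K| ≥ r₁(log 4π + γ + 0.942) + 2r₂(log 2π + γ + 0.652) − (183/50)√(π²n/2) − 76`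
(for `√(π²n/2) ≥ 40` take `h = 2/√(π²n/2)`; otherwise `h = 1/20`).
[cite: Odlyzko1977, Theorem 1 (method; three-difference instance)] -/
theorem log_absdiscr_ge_sharp_signature :
    (nrRealPlaces K : ℝ) * (Real.log (4 * Real.pi) + Real.eulerMascheroniConstant + 0.942) +
        2 * (nrComplexPlaces K : ℝ) * (Real.log (2 * Real.pi) + Real.eulerMascheroniConstant + 0.652) -
        183 / 50 * Real.sqrt (Real.pi ^ 2 * Module.finrank ℚ K / 2) - 76 ≤
      Real.log ((discr K).natAbs : ℝ) := by
  set n : ℕ := Module.finrank ℚ K with hn_def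
  set s : ℝ := Real.sqrt (Real.pi ^ 2 * n / 2) with hs_def
  have hπ0 := Real.pi_pos
  have hs2 : s ^ 2 = Real.pi ^ 2 * n / 2 := by rw [hs_def, Real.sq_sqrt (by positivity)]
  have hs0 : 0 < s := by
    rw [hs_def]
    refine Real.sqrt_pos.2 ?_
    have : (1 : ℝ) ≤ n := by rw [hn_def]; exact_mod_cast Module.finrank_pos
    positivity
  have hrank : (nrRealPlaces K : ℝ) + 2 * nrComplexPlaces K = n := by
    rw [hn_def]; exact_mod_cast card_add_two_mul_card_eq_rank K
  have hr1 : (0 : ℝ) ≤ nrRealPlaces K := Nat.cast_nonneg _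
  have hr2 : (0 : ℝ) ≤ nrComplexPlaces K := Nat.cast_nonneg _
  -- the slope terms at step `h` cost at most `n (183π²/400) h`
  have hslope : ∀ h : ℝ, 0 ≤ h →
      (nrRealPlaces K : ℝ) * (183 * Real.pi ^ 2 / 400 * h) +
        2 * (nrComplexPlaces K : ℝ) * (183 * Real.pi ^ 2 / 600 * h) ≤
          n * (183 * Real.pi ^ 2 / 400 * h) := by
    intro h hh
    rw [← hrank]
    nlinarith [mul_nonneg hr2 (mul_nonneg (sq_nonneg Real.pi) hh)]
  rcases le_or_gt 40 s with hs40 | hs40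
  · -- `h = 2/s ≤ 1/20`
    have hh : 0 < 2 / s := by positivity
    have hh' : 2 / s ≤ 1 / 20 := by
      rw [div_le_div_iff₀ hs0 (by norm_num)]; linarith
    have hmain := log_absdiscr_ge_sharp_linear K hh hh'
    have ht1 : (n : ℝ) * (183 * Real.pi ^ 2 / 400 * (2 / s)) = 183 / 100 * s := by
      calc (n : ℝ) * (183 * Real.pi ^ 2 / 400 * (2 / s))
          = 183 / 100 * ((Real.pi ^ 2 * n / 2) / s) := by ring
        _ = 183 / 100 * (s ^ 2 / s) := by rw [← hs2]
        _ = 183 / 100 * s := by rw [sq, mul_div_cancel_right₀ _ hs0.ne']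
    have ht2 : 1 / (2 / s) = s / 2 := by field_simp
    have ht3 : 1 / (1 + 2 / s) ≤ 1 := by
      rw [div_le_iff₀ (by positivity)]; nlinarith
    rw [ht2] at hmain
    have hsl := hslope (2 / s) hh.le
    linarith [hmain, hsl, ht1, ht3]
  · -- `h = 1/20`; here `s < 40`, so the slope cost `n · 183π²/8000 = (183/4000) s² ≤ (183/100) s`
    have hmain := log_absdiscr_ge_sharp_linear K (h := 1 / 20) (by norm_num) le_rfl
    have hsl := hslope (1 / 20) (by norm_num)
    have ht1 : (n : ℝ) * (183 * Real.pi ^ 2 / 400 * (1 / 20)) = 183 / 4000 * s ^ 2 := by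
      rw [hs2]; ring
    rw [ht1] at hsl
    have hsq : 183 / 4000 * s ^ 2 ≤ 183 / 100 * s := by nlinarith
    have e5 : (1 : ℝ) / (1 / 20) = 20 := by norm_num
    have e6 : (1 : ℝ) / (1 + 1 / 20) = 20 / 21 := by norm_num
    rw [e5, e6] at hmain
    linarith [hmain, hsl, hsq]

/-- **Exponentiated form**: `|d_K| ≥ (4πe^{γ+0.942})^{r₁}(2πe^{γ+0.652})^{2r₂}·e^{−(183/50)√(π²n/2) − 76}`
for every number field `K` of degree `n`. [cite: Odlyzko1977, Theorem 1 (method; three-difference instance)] -/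
theorem absdiscr_ge_sharp_signature :
    (4 * Real.pi * Real.exp (Real.eulerMascheroniConstant + 0.942)) ^ nrRealPlaces K *
        (2 * Real.pi * Real.exp (Real.eulerMascheroniConstant + 0.652)) ^ (2 * nrComplexPlaces K) *
        Real.exp (-(183 / 50 * Real.sqrt (Real.pi ^ 2 * Module.finrank ℚ K / 2) + 76)) ≤
      ((discr K).natAbs : ℝ) := by
  have h := log_absdiscr_ge_sharp_signature K
  have hπ0 := Real.pi_pos
  have hd : 0 < ((discr K).natAbs : ℝ) := by exact_mod_cast Int.natAbs_pos.mpr (discr_ne_zero K)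
  have e4 : 4 * Real.pi * Real.exp (Real.eulerMascheroniConstant + 0.942) =
      Real.exp (Real.log (4 * Real.pi) + Real.eulerMascheroniConstant + 0.942) := by
    simp only [Real.exp_add, Real.exp_log (show (0 : ℝ) < 4 * Real.pi by positivity)]
    ring
  have e2 : 2 * Real.pi * Real.exp (Real.eulerMascheroniConstant + 0.652) =
      Real.exp (Real.log (2 * Real.pi) + Real.eulerMascheroniConstant + 0.652) := by
    simp only [Real.exp_add, Real.exp_log (show (0 : ℝ) < 2 * Real.pi by positivity)]
    ring
  rw [e4, e2, ← Real.exp_nat_mul, ← Real.exp_nat_mul, ← Real.exp_add, ← Real.exp_add,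
    ← Real.exp_log hd, Real.exp_le_exp]
  push_cast
  linarith

/-! ### Numerics: `4πe^{γ+0.942} > 57.4`, `2πe^{γ+0.652} > 21.47` -/

/-- `e^{0.942} ≥ 2.565`. [folklore] -/
private theorem exp_0942_ge : (2.565 : ℝ) ≤ Real.exp 0.942 := by
  have h2 := Real.sum_le_exp_of_nonneg (show (0 : ℝ) ≤ 0.942 by norm_num) 8
  have h3 : (2.565 : ℝ) ≤ ∑ i ∈ Finset.range 8, (0.942 : ℝ) ^ i / (i.factorial : ℝ) := by
    simp only [Finset.sum_range_succ, Finset.sum_range_zero, Nat.factorial]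
    norm_num
  linarith

/-- `e^{0.652} ≥ 1.9193`. [folklore] -/
private theorem exp_0652_ge : (1.9193 : ℝ) ≤ Real.exp 0.652 := by
  have h2 := Real.sum_le_exp_of_nonneg (show (0 : ℝ) ≤ 0.652 by norm_num) 7
  have h3 : (1.9193 : ℝ) ≤ ∑ i ∈ Finset.range 7, (0.652 : ℝ) ^ i / (i.factorial : ℝ) := by
    simp only [Finset.sum_range_succ, Finset.sum_range_zero, Nat.factorial]
    norm_num
  linarith

/-- **`4πe^{γ+0.942} > 57.4`** (the real-place constant of the three-difference bound; Odlyzko's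
published estimates by this method: `58.6` [(5)], `60.1` [(4)]; limit of the method `60.8`). [folklore] -/
theorem lt_four_pi_exp_sharp :
    (57.4 : ℝ) < 4 * Real.pi * Real.exp (Real.eulerMascheroniConstant + 0.942) := by
  have h := Discriminant.lt_four_pi_exp_eulerMascheroni
  have he := exp_0942_ge
  rw [Real.exp_add, ← mul_assoc]
  nlinarith [Real.exp_pos Real.eulerMascheroniConstant, Real.pi_pos]

/-- **`2πe^{γ+0.652} > 21.47`** (the complex-place constant of the three-difference bound; Odlyzko's
published estimates by this method: `21.8` [(5)], `22.2` [(4)]; limit of the method `22.38`).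
[folklore] -/
theorem lt_two_pi_exp_sharp :
    (21.47 : ℝ) < 2 * Real.pi * Real.exp (Real.eulerMascheroniConstant + 0.652) := by
  have h := Discriminant.lt_two_pi_exp_eulerMascheroni
  have he := exp_0652_ge
  rw [Real.exp_add, ← mul_assoc]
  nlinarith [Real.exp_pos Real.eulerMascheroniConstant, Real.pi_pos]

/-- **Numeric form**: `|d_K| ≥ 21.47^n · e^{−(183/50)√(π²n/2) − 76}` for every number field `K` of
degree `n`. [cite: Odlyzko1977, Theorem 1 (method)] -/
theorem absdiscr_ge_sharp_numeric :
    (21.47 : ℝ) ^ Module.finrank ℚ K *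
        Real.exp (-(183 / 50 * Real.sqrt (Real.pi ^ 2 * Module.finrank ℚ K / 2) + 76)) ≤
      ((discr K).natAbs : ℝ) := by
  have h := absdiscr_ge_sharp_signature K
  have h4 := lt_four_pi_exp_sharp
  have h2 := lt_two_pi_exp_sharp
  have h42 : 2 * Real.pi * Real.exp (Real.eulerMascheroniConstant + 0.652) ≤
      4 * Real.pi * Real.exp (Real.eulerMascheroniConstant + 0.942) := by
    have := Real.exp_le_exp.2
      (show Real.eulerMascheroniConstant + 0.652 ≤ Real.eulerMascheroniConstant + 0.942 by norm_num)
    nlinarith [Real.exp_pos (Real.eulerMascheroniConstant + 0.652), Real.pi_pos]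
  have hrank : nrRealPlaces K + 2 * nrComplexPlaces K = Module.finrank ℚ K :=
    card_add_two_mul_card_eq_rank K
  refine le_trans ?_ h
  gcongr ?_ * _
  calc (21.47 : ℝ) ^ Module.finrank ℚ K
      = 21.47 ^ nrRealPlaces K * 21.47 ^ (2 * nrComplexPlaces K) := by rw [← pow_add, hrank]
    _ ≤ (4 * Real.pi * Real.exp (Real.eulerMascheroniConstant + 0.942)) ^ nrRealPlaces K *
          (2 * Real.pi * Real.exp (Real.eulerMascheroniConstant + 0.652)) ^ (2 * nrComplexPlaces K) := by
        gcongr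
        · linarith

/-- **Numeric form, totally real fields**: `|d_K| ≥ 57.4^n · e^{−(183/50)√(π²n/2) − 76}` for every
totally real number field `K` of degree `n`. [cite: Odlyzko1977, Theorem 1 (method)] -/
theorem absdiscr_ge_sharp_numeric_totallyReal [IsTotallyReal K] :
    (57.4 : ℝ) ^ Module.finrank ℚ K *
        Real.exp (-(183 / 50 * Real.sqrt (Real.pi ^ 2 * Module.finrank ℚ K / 2) + 76)) ≤
      ((discr K).natAbs : ℝ) := by
  have h := absdiscr_ge_sharp_signature K
  have h4 := lt_four_pi_exp_sharp
  rw [IsTotallyReal.nrComplexPlaces_eq_zero, mul_zero, pow_zero, mul_one,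
    ← IsTotallyReal.finrank] at h
  refine le_trans ?_ h
  gcongr

/-! ### Asymptotic root-discriminant bounds -/

/-- Elementary step: for `δ > 0` there is `N` such that `(183/50)√(π²n/2) + 76 ≤ δ·n` for all
`n ≥ N`. [folklore] -/
theorem exists_sqrt_error_le_sharp {δ : ℝ} (hδ : 0 < δ) :
    ∃ N : ℕ, ∀ n : ℕ, N ≤ n → 183 / 50 * Real.sqrt (Real.pi ^ 2 * n / 2) + 76 ≤ δ * n := by
  obtain ⟨N₁, hN₁⟩ := Discriminant.exists_sqrt_error_le (show 0 < δ / (183 / 25) by positivity)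
  obtain ⟨N₂, hN₂⟩ := exists_nat_ge (146 / δ)
  refine ⟨max N₁ N₂, fun n hn ↦ ?_⟩
  have h1 := hN₁ n (le_trans (le_max_left _ _) hn)
  have h2 : (146 / δ : ℝ) ≤ n := le_trans hN₂ (by exact_mod_cast le_trans (le_max_right _ _) hn)
  have h3 : 146 ≤ δ * n := by
    have := (div_le_iff₀ hδ).1 h2
    linarith
  have h4 : 183 / 50 * Real.sqrt (Real.pi ^ 2 * n / 2) + 183 / 50 ≤ δ / 2 * n := by
    have := mul_le_mul_of_nonneg_left h1 (show (0 : ℝ) ≤ 183 / 100 by norm_num)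
    linarith
  linarith

/-- **Asymptotic root-discriminant bound (three differences)**: for every `θ < 2πe^{γ+0.652} ≈ 21.48`
there is `N` such that `|d_K| ≥ θ^n` for every number field `K` of degree `n ≥ N`.
[cite: Odlyzko1977, Theorem 1 (method; three-difference instance)] -/
theorem exists_pow_le_absdiscr_of_lt_sharp {θ : ℝ} (hθ0 : 0 ≤ θ)
    (hθ : θ < 2 * Real.pi * Real.exp (Real.eulerMascheroniConstant + 0.652)) :
    ∃ N : ℕ, ∀ (K : Type) [Field K] [NumberField K], N ≤ Module.finrank ℚ K →
      θ ^ Module.finrank ℚ K ≤ ((discr K).natAbs : ℝ) := by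
  have hπ0 := Real.pi_pos
  rcases hθ0.eq_or_lt with rfl | hθpos
  · refine ⟨1, fun K _ _ hn ↦ ?_⟩
    rw [zero_pow (by omega)]
    exact Nat.cast_nonneg _
  set C : ℝ := 2 * Real.pi * Real.exp (Real.eulerMascheroniConstant + 0.652) with hC
  have hC0 : 0 < C := by positivity
  have hδ : 0 < Real.log C - Real.log θ := by
    have := Real.log_lt_log hθpos hθ
    linarith
  obtain ⟨N, hN⟩ := exists_sqrt_error_le_sharp hδ
  refine ⟨N, fun K _ _ hn ↦ ?_⟩
  have h := log_absdiscr_ge_sharp_signature K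
  have herr := hN _ hn
  have hd : 0 < ((discr K).natAbs : ℝ) := by exact_mod_cast Int.natAbs_pos.mpr (discr_ne_zero K)
  have hrank : (nrRealPlaces K : ℝ) + 2 * nrComplexPlaces K = Module.finrank ℚ K := by
    exact_mod_cast card_add_two_mul_card_eq_rank K
  have hr1 : (0 : ℝ) ≤ nrRealPlaces K := Nat.cast_nonneg _
  have hlogC : Real.log C = Real.log (2 * Real.pi) + Real.eulerMascheroniConstant + 0.652 := by
    rw [hC, Real.log_mul (by positivity) (Real.exp_pos _).ne', Real.log_exp, add_assoc]
  have h42 : Real.log (2 * Real.pi) + Real.eulerMascheroniConstant + 0.652 ≤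
      Real.log (4 * Real.pi) + Real.eulerMascheroniConstant + 0.942 := by
    have := Real.log_le_log (by positivity : 0 < 2 * Real.pi) (by linarith : 2 * Real.pi ≤ 4 * Real.pi)
    linarith
  have e1 := mul_le_mul_of_nonneg_left h42 hr1
  have e3 : (Module.finrank ℚ K : ℝ) * Real.log C =
      ((nrRealPlaces K : ℝ) + 2 * nrComplexPlaces K) *
        (Real.log (2 * Real.pi) + Real.eulerMascheroniConstant + 0.652) := by
    rw [hrank, hlogC]
  have hlog : (Module.finrank ℚ K : ℝ) * Real.log θ ≤ Real.log ((discr K).natAbs : ℝ) := by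
    linarith [h, e1, e3, herr]
  have := Real.exp_le_exp.2 hlog
  rwa [Real.exp_nat_mul, Real.exp_log hθpos, Real.exp_log hd] at this

/-- **Asymptotic root-discriminant bound, totally real fields (three differences)**: for every
`θ < 4πe^{γ+0.942} ≈ 57.41` there is `N` such that `|d_K| ≥ θ^n` for every totally real number field
`K` of degree `n ≥ N`. [cite: Odlyzko1977, Theorem 1 (method; three-difference instance)] -/
theorem exists_pow_le_absdiscr_totallyReal_of_lt_sharp {θ : ℝ} (hθ0 : 0 ≤ θ)
    (hθ : θ < 4 * Real.pi * Real.exp (Real.eulerMascheroniConstant + 0.942)) :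
    ∃ N : ℕ, ∀ (K : Type) [Field K] [NumberField K] [IsTotallyReal K], N ≤ Module.finrank ℚ K →
      θ ^ Module.finrank ℚ K ≤ ((discr K).natAbs : ℝ) := by
  have hπ0 := Real.pi_pos
  rcases hθ0.eq_or_lt with rfl | hθpos
  · refine ⟨1, fun K _ _ _ hn ↦ ?_⟩
    rw [zero_pow (by omega)]
    exact Nat.cast_nonneg _
  set C : ℝ := 4 * Real.pi * Real.exp (Real.eulerMascheroniConstant + 0.942) with hC
  have hC0 : 0 < C := by positivity
  have hδ : 0 < Real.log C - Real.log θ := by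
    have := Real.log_lt_log hθpos hθ
    linarith
  obtain ⟨N, hN⟩ := exists_sqrt_error_le_sharp hδ
  refine ⟨N, fun K _ _ _ hn ↦ ?_⟩
  have h := log_absdiscr_ge_sharp_signature K
  rw [IsTotallyReal.nrComplexPlaces_eq_zero] at h
  have herr := hN _ hn
  have hd : 0 < ((discr K).natAbs : ℝ) := by exact_mod_cast Int.natAbs_pos.mpr (discr_ne_zero K)
  have hrank : (nrRealPlaces K : ℝ) = Module.finrank ℚ K := by
    exact_mod_cast (IsTotallyReal.finrank K).symm
  have hlogC : Real.log C = Real.log (4 * Real.pi) + Real.eulerMascheroniConstant + 0.942 := by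
    rw [hC, Real.log_mul (by positivity) (Real.exp_pos _).ne', Real.log_exp, add_assoc]
  have e3 : (Module.finrank ℚ K : ℝ) * Real.log C =
      (nrRealPlaces K : ℝ) * (Real.log (4 * Real.pi) + Real.eulerMascheroniConstant + 0.942) := by
    rw [← hrank, hlogC]
  have hlog : (Module.finrank ℚ K : ℝ) * Real.log θ ≤ Real.log ((discr K).natAbs : ℝ) := by
    push_cast at h
    linarith [h, herr, e3]
  have := Real.exp_le_exp.2 hlog
  rwa [Real.exp_nat_mul, Real.exp_log hθpos, Real.exp_log hd] at this

end OdlyzkoSharp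

end Summit.QuantumAdvantage.QuantumAdvantage.Theorems.DegreeOnePrimesEscape
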